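import Summits.SmoothPoincare4.SmoothPoincare4.Theorems.ConvexBisectionAcyclicBisectionExistsPageInvarianceTwisting
import Literature.Geometry.Symplectic.TwoHandleIsotopyFraming
import Literature.Topology.FourManifolds.HandleAttachingMapsTransport
import HarnessLib

/-!
# Pushing framed knots of `∂ Base g` by an ambient isotopy (the rotation phase of node T3c-1′)
(node T3c-1′ `node_belt_isotopic_pushoff` of the sub-goal T3 of stub `stub_steinRealisation` (NF6), line
`modp-braid-orbits`, crux `ConvexBisection.AcyclicBisectionExists`, item stmt-SmoothPoincare4-10508;
wave 4, worker Y1, lead c5; assembly part 2 (tool), registered sub-goal `helper_belt_ambientPush`)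

The last phase of the isotopy of node T3c-1′ rotates the page push-off of the vanishing cycle (a framed knot in the
page of angle `-κμη'`) to the prescribed page of angle `-η` by the page-rotation isotopy `R` of the base
(`helper_exists_pageTube`, `helper_rotFlow_fix`).  This file provides the general tool, the ambient analogue of
`…BeltBasePush.lean` (which pushes through the embedding `jA`): for an ambient isotopy `R` of `Base g`, a time
`τ` and a knot `K` in `∂ Base g`,

* `isotopyAmbient R τ hK : KnotIsotopyInBoundary K (R_τ ∘ K)` with stages `R_{tτ} ∘ K` (diffeomorphisms preserve
  the boundary and composed with an embedding give an embedding);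
* `isKnotFraming_ambient_push`: `d(R_s) ν` is a framing of `R_s ∘ K` for a framing `ν` of `K` (tangent to the
  boundary by `mfderiv_apply_zero_of_isBoundaryPoint`, nowhere tangent since `d(R_s)` is injective and
  `(R_s ∘ K)˙ = d(R_s) K̇`);
* `isFramingAlong_ambient_push`: the family `(t, u) ↦ d(R_{tτ}) (ν u)` is carried along `isotopyAmbient`
  (joint continuity: `continuous_mfderiv_ambientIsotopy_bundle`);
* the registered helper `helper_belt_ambientPush` (existential packaging).

Everything is proved; no named facts, no `sorry`.

## References
* M. W. Hirsch, *Differential Topology*, GTM 33 (1976), Ch. 8 §1 (isotopy). [Hirsch1976]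
* A. A. Kosinski, *Differential Manifolds*, Academic Press (1993), VI §6. [Kosinski1993]
-/

noncomputable section

-- the prescribed namespace `Summit.<P>.<Sub>.…` duplicates `SmoothPoincare4` (P = Sub)
set_option linter.dupNamespace false

open scoped Manifold ContDiff Topology
open Set Function Metric Filter Bundle

namespace Summit.SmoothPoincare4.SmoothPoincare4.Theorems.AcyclicBisectionExists.ModpBraidOrbits

open Literature.Topology.FourManifolds Literature.Topology.FourManifolds.LefschetzBase
  Literature.Geometry.Symplectic

variable {g : ℕ} (R : AmbientIsotopy (𝓡∂ 4) (Base g))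

/-! ### §1 Stages of an ambient isotopy preserve the boundary; their differentials are injective -/

/-- Every stage of an ambient isotopy maps boundary points to boundary points. [cite: Hirsch1976, Ch. 8 §1] -/
theorem isBoundaryPoint_ambient (s : ℝ) {x : Base g} (hx : (𝓡∂ 4).IsBoundaryPoint x) :
    (𝓡∂ 4).IsBoundaryPoint (R.toFun s x) := by
  have himg : R.toFun s x ∈ (R.toDiffeomorph s) '' (𝓡∂ 4).boundary (Base g) := ⟨x, hx, rfl⟩
  rw [Diffeomorph.image_boundary (by simp) (R.toDiffeomorph s)] at himg
  exact himg

/-- Every stage of an ambient isotopy is differentiable. [folklore] -/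
theorem mdifferentiableAt_ambient (s : ℝ) (x : Base g) : MDifferentiableAt (𝓡∂ 4) (𝓡∂ 4) (R.toFun s) x :=
  (R.toDiffeomorph s).contMDiff.mdifferentiableAt (by simp)

/-- The differential of a stage of an ambient isotopy is injective. [folklore] -/
theorem injective_mfderiv_ambient (s : ℝ) (x : Base g) : Injective (mfderiv (𝓡∂ 4) (𝓡∂ 4) (R.toFun s) x) := by
  intro a b hab
  have e := ((R.isLocalDiffeomorph s) x).mfderivToContinuousLinearEquiv_coe (n := ∞) (by simp)
  apply (((R.isLocalDiffeomorph s) x).mfderivToContinuousLinearEquiv (n := ∞) (by simp)).injective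
  show ((((R.isLocalDiffeomorph s) x).mfderivToContinuousLinearEquiv (n := ∞) (by simp) :
      TangentSpace (𝓡∂ 4) x →L[ℝ] TangentSpace (𝓡∂ 4) (R.toFun s x))) a =
    ((((R.isLocalDiffeomorph s) x).mfderivToContinuousLinearEquiv (n := ∞) (by simp) :
      TangentSpace (𝓡∂ 4) x →L[ℝ] TangentSpace (𝓡∂ 4) (R.toFun s x))) b
  rw [e]
  exact hab

/-- **`d(R_s)` maps vectors tangent to `∂ Base g` to vectors tangent to `∂ Base g`** (at boundary points).
[folklore] -/
theorem mfderiv_ambient_mem_boundaryTangentSpace (s : ℝ) {x : Base g} (hx : (𝓡∂ 4).IsBoundaryPoint x)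
    {v : EuclideanSpace ℝ (Fin 4)} (hv : v ∈ boundaryTangentSpace) :
    mfderiv (𝓡∂ 4) (𝓡∂ 4) (R.toFun s) x v ∈ boundaryTangentSpace :=
  (mem_boundaryTangentSpace_iff _).2 (mfderiv_apply_zero_of_isBoundaryPoint (mdifferentiableAt_ambient R s x) hx
    (Filter.Eventually.of_forall fun _ hy => isBoundaryPoint_ambient R s hy) ((mem_boundaryTangentSpace_iff _).1 hv))

/-! ### §2 The isotopy of knots `t ↦ R_{tτ} ∘ K` -/

section Isotopy

variable (τ : ℝ) {K : sphere (0 : EuclideanSpace ℝ (Fin 2)) 1 → Base g}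

/-- **The isotopy of knots in `∂ Base g` swept out by an ambient isotopy**: stages `R_{tτ} ∘ K`, from `K`
(`t = 0`) to `R_τ ∘ K` (`t = 1`). [cite: Hirsch1976, Ch. 8 §1] -/
def isotopyAmbient (hK : IsBoundaryKnot K) : KnotIsotopyInBoundary K (fun u => R.toFun τ (K u)) where
  toFun t u := R.toFun (t * τ) (K u)
  contMDiff := by
    have hmul : ContMDiff 𝓘(ℝ, ℝ) 𝓘(ℝ, ℝ) ∞ (fun t : ℝ => t * τ) := (contDiff_id.mul contDiff_const).contMDiff
    exact R.contMDiff.comp ((hmul.comp contMDiff_fst).prodMk (hK.isSmoothEmbedding.contMDiff.comp contMDiff_snd))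
  isSmoothEmbedding t := hK.isSmoothEmbedding.diffeomorph_comp (R.toDiffeomorph (t * τ))
  map_zero := by
    funext u
    show R.toFun (0 * τ) (K u) = K u
    rw [zero_mul, R.map_zero]
    rfl
  map_one := by
    funext u
    show R.toFun (1 * τ) (K u) = R.toFun τ (K u)
    rw [one_mul]
  isBoundaryPoint t _ u := isBoundaryPoint_ambient R _ (hK.isBoundaryPoint u)

/-- Stages of `isotopyAmbient`. [folklore] -/
@[simp] theorem isotopyAmbient_toFun (hK : IsBoundaryKnot K) (t : ℝ) :
    (isotopyAmbient R τ hK).toFun t = fun u => R.toFun (t * τ) (K u) := rfl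

/-- **The velocity of the pushed knot is the pushed velocity**: `(R_s ∘ K)˙ = d(R_s) K̇`. [folklore] -/
theorem knotVelocity_ambient (s : ℝ) (hK : ContMDiff (𝓡 1) (𝓡∂ 4) ∞ K) (t : ℝ) :
    knotVelocity (fun u => R.toFun s (K u)) t = mfderiv (𝓡∂ 4) (𝓡∂ 4) (R.toFun s) (K (circlePt t)) (knotVelocity K t) := by
  have hc : MDifferentiableAt 𝓘(ℝ, ℝ) (𝓡∂ 4) (K ∘ circlePt) t :=
    ((hK _).comp t contMDiff_circlePt.contMDiffAt).mdifferentiableAt (by simp)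
  have h := mfderiv_comp t (mdifferentiableAt_ambient R s (K (circlePt t))) hc
  unfold knotVelocity
  exact congrArg (fun L : ℝ →L[ℝ] EuclideanSpace ℝ (Fin 4) => L 1) h

/-- **A framing pushed by a stage of an ambient isotopy is a framing of the pushed knot.**
[cite: Kosinski1993, VI §6] -/
theorem isKnotFraming_ambient_push (s : ℝ) (hK : IsBoundaryKnot K)
    {ν : sphere (0 : EuclideanSpace ℝ (Fin 2)) 1 → EuclideanSpace ℝ (Fin 4)} (hν : IsKnotFraming K ν) :
    IsKnotFraming (fun u => R.toFun s (K u)) fun u => mfderiv (𝓡∂ 4) (𝓡∂ 4) (R.toFun s) (K u) (ν u) where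
  continuous := by
    have h1 : Continuous (tangentMap (𝓡∂ 4) (𝓡∂ 4) (R.toFun s)) :=
      (R.toDiffeomorph s).contMDiff.continuous_tangentMap (by simp)
    exact (h1.comp hν.continuous).congr fun u => rfl
  mem_boundaryTangentSpace u :=
    mfderiv_ambient_mem_boundaryTangentSpace R s (hK.isBoundaryPoint u) (hν.mem_boundaryTangentSpace u)
  not_mem_span t := by
    rw [knotVelocity_ambient R s hK.isSmoothEmbedding.contMDiff t, Submodule.mem_span_singleton]
    rintro ⟨c, hc⟩
    have hinj := injective_mfderiv_ambient R s (K (circlePt t))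
    apply hν.not_mem_span t
    rw [Submodule.mem_span_singleton]
    exact ⟨c, hinj (((mfderiv (𝓡∂ 4) (𝓡∂ 4) (R.toFun s) (K (circlePt t))).map_smul c (knotVelocity K t)).trans hc)⟩

/-- **A framing is carried along the isotopy swept out by an ambient isotopy, by the differentials of the
stages.** [cite: Kosinski1993, VI §6] -/
theorem isFramingAlong_ambient_push (hK : IsBoundaryKnot K)
    {ν : sphere (0 : EuclideanSpace ℝ (Fin 2)) 1 → EuclideanSpace ℝ (Fin 4)} (hν : IsKnotFraming K ν) :
    IsFramingAlong (isotopyAmbient R τ hK) ν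
      fun t u => mfderiv (𝓡∂ 4) (𝓡∂ 4) (R.toFun (t * τ)) (K u) (ν u) where
  apply_zero := by
    funext u
    show mfderiv (𝓡∂ 4) (𝓡∂ 4) (R.toFun (0 * τ)) (K u) (ν u) = ν u
    rw [zero_mul, R.map_zero, mfderiv_id]
    rfl
  isKnotFraming t _ := isKnotFraming_ambient_push R (t * τ) hK hν
  continuousOn := by
    have h := continuous_mfderiv_ambientIsotopy_bundle R hν.continuous
    have h2 : Continuous fun p : ℝ × (sphere (0 : EuclideanSpace ℝ (Fin 2)) 1) => ((p.1 * τ, p.2) : ℝ × _) := by fun_prop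
    exact ((h.comp h2).congr fun p => rfl).continuousOn

end Isotopy

/-! ### §3 Registered helper -/

/-- **Registered helper `helper_belt_ambientPush` (node T3c-1′ of NF6 `stub_steinRealisation`, assembly part 2
tool = the rotation phase, wave 4, lead c5): an ambient isotopy `R` of `Base g` sweeps a framed knot `(K, ν)` of
`∂ Base g` to `(R_τ ∘ K, d(R_τ) ν)` through the framed knots `(R_{tτ} ∘ K, d(R_{tτ}) ν)`.**
[cite: Kosinski1993, VI §6] -/
theorem helper_belt_ambientPush : ∀ (g : ℕ)
    (R : Literature.Topology.FourManifolds.AmbientIsotopy (𝓡∂ 4) (Literature.Topology.FourManifolds.LefschetzBase.Base g))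
    (τ : ℝ) (K : Metric.sphere (0 : EuclideanSpace ℝ (Fin 2)) 1 → Literature.Topology.FourManifolds.LefschetzBase.Base g)
    (ν : Metric.sphere (0 : EuclideanSpace ℝ (Fin 2)) 1 → EuclideanSpace ℝ (Fin 4)),
    Literature.Geometry.Symplectic.IsBoundaryKnot K → Literature.Geometry.Symplectic.IsKnotFraming K ν →
    ∃ Ψ : Literature.Geometry.Symplectic.KnotIsotopyInBoundary K (fun u => R.toFun τ (K u)),
      (∀ t u, Ψ.toFun t u = R.toFun (t * τ) (K u)) ∧
      Literature.Geometry.Symplectic.IsFramingAlong Ψ ν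
        (fun t u => mfderiv (𝓡∂ 4) (𝓡∂ 4) (R.toFun (t * τ)) (K u) (ν u)) := by
  intro g R τ K ν hK hν
  exact ⟨isotopyAmbient R τ hK, fun t u => rfl, isFramingAlong_ambient_push R τ hK hν⟩

end Summit.SmoothPoincare4.SmoothPoincare4.Theorems.AcyclicBisectionExists.ModpBraidOrbits

end
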